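import Summits.BirchSwinnertonDyer.Rank1Residual.GaloisImage.KuriharaRecordCorollaryThreeDeep
import Summits.BirchSwinnertonDyer.Rank1Residual.GaloisImage.KuriharaRecordBSDpThreeLevelTwoEndNoEP
import Summits.BirchSwinnertonDyer.Rank1Residual.GaloisImage.KatoKuriharaPortThreeWith
import Summits.BirchSwinnertonDyer.BirchSwinnertonDyer.Theorems.KimAtThreeDeepLowerKatoStratumOfFacts
import Summits.BirchSwinnertonDyer.BirchSwinnertonDyer.Theorems.KimAtThreeKolyvaginMinimalCertificate
import HarnessLib

/-!
# Crux `DeepLowerAtThree` (item 19075) for EVERY `t` on the additive `3 ∤ c₃` tower stratum, GRANTED the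
# REPAIRED shared-generator port `KatoKuriharaPortThreeAtWith W t v₃ η` (PORT′) — route W2
# `KimAtThreeKolyvagin`, cell `bsd-addord`, seat w2-c2 (D-0074 row B5)

HONEST FRAMING. Theorems only (no definition, no named fact minted, no `sorry`); nothing asserted,
nothing booked; crux 19075 stays OPEN. This file REPLACES, as evidence, this seat's files
`KimAtThreeDeepLowerDeepPortStratum.lean` / `KimAtThreeDeepLowerDeepPortManin.lean`: those are keyed to
the universal-closure port `KatoKuriharaPortThreeAt W t v₃`, which cell n1011's T-PORT-NEG
(`GaloisImage/KatoKuriharaPortThreeRefutation.lean`) REFUTES at `t = 0` on its unit rows (generator-sign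
anomaly), so as rungs they are VACUOUS. Here the dictionary is taken from the REPAIRED η-keyed
closure PORT′ `KatoKuriharaPortThreeAtWith W t v₃ η` (planner r1 GEN 47 (R-ii), lead R5-110 (n3)(β);
FLAG `K22-Thm3.13-PORT@3`, Kim's refined explicit reciprocity law at an additive `3`, not in print at
`3`; its standing is DICT3₂'s — one Euler system, one generator), which relates only Kolyvagin data
canonical for ONE family of primitive roots `η`. That requires the DEEP family of n1011
(`S24Deep.exists_deepFamily_of_towerSurj`, generators chosen per depth) to be re-run with ONE SHARED
`η`, exactly as `TowerPackage.exists_towerFamily_with` re-ran the pinned family; n1011's η-INPUT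
constructor `S24Deep.exists_kolyvaginDatum_hasCanonicalComparison_frobeniusClassPrimes_deep` makes this
a bookkeeping change (§1–§2, proofs adapted verbatim, credit cell b2b-bsdres team n1011, seats
p04/p15/p18). §3 is n1011's deep record corollary `Assembly.exists_LOmega_padicValRat_le_of_towerSurj_deep`
re-run on that family with PORT′, the Manin datum displayed (`3 ∤ c_D` + period transfer), `L(E,1) ≠ 0`
in place of `analyticRank = 0` + modularity, Tate's `hEP` discharged by name
(`Assembly.localEulerPoincareCharacteristic_rat`) and the Poitou–Tate families from the named fact
`poitouTate_selmerStructure_duality ℚ`; §4 turns it into the `∂`-currency conclusion of item 19075 via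
kim3's `deepLower_datum_of_endShapeBound` at the threshold `K = 2t + 1`.
PRICE (by name, nothing asserted): the two S24-DEEP ports `hS24d`/`hS24d₂` (FLAG `S24-DEEP-PORT@3`:
[S24] Thm. 4.4 (1)(2) on DEEP Frobenius sub-classes, NOT the printed theorem — the `t = 0` rung of seat
kim3 uses printed [S24] instead), GZK `hGZK`, Poitou–Tate `hPT`, ONE port PORT′.
ROW: `3`-adic tower onto, ADDITIVE `3`, `3 ∤ c₃`, `#E(ℚ₃)[3] = 3^t`, a parametrisation datum at the
conductor with `3 ∤ c_D` (+ period transfer / optimality). NOT COVERED: `3 ∣ c₃`, non-additive `3`,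
`3 ∣ c_D`; and the keyed-at-`P` closure PORT″ (`KatoKuriharaPortThreeAtWith₂`, the port of record of the
`t = 0` rung) would need the deep END re-keyed at `P` — not done here (PORT′ ⟹ PORT″ `P` for every `P`,
`KatoKuriharaPortThreeAtWith.toWith₂`, so this file's hypothesis is the stronger one).

References: [Kim2025RefinedTNC] Thm 1.1; [Kim2022StructureSelmer] Thm. 1.9 (6), Thm. 3.13, §2.2.2;
[Sakamoto2024] §2, Thm. 4.4, Def. 4.1; [MazurRubin2004] §3.5 (H.5), Thm. 3.2.4, Prop. A.2, Thm. 5.2.12;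
[Rubin2011] Def. 1.9.6, Def. 2.1.3; [MilneADT2006] I Thm. 4.10; memo `kim3/KIM3-PROOF.md` §14, §16.
-/

-- the Theorems namespace of a single-conjunct summit repeats the summit name by design (D-0017)
set_option linter.dupNamespace false

noncomputable section

open scoped Classical NumberField ContRepresentation
open Function Field NumberField IsDedekindDomain IsDedekindDomain.HeightOneSpectrum WeierstrassCurve
  CongruenceSubgroup
  Literature.NumberTheory.EllipticCurves Literature.NumberTheory.EllipticCurves.ModularForms
  Literature.NumberTheory.EllipticCurves.Rank1Residual
  Literature.NumberTheory.GaloisRepresentations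
  Literature.NumberTheory.GaloisRepresentations.DiscreteGaloisModule Literature.NumberTheory.GaloisCohomology
  Rat.HeightOneSpectrum
  Summit.BirchSwinnertonDyer.Rank1Residual.GaloisImage
  Summit.BirchSwinnertonDyer.Rank1Residual.GaloisImage.Assembly
  Summit.BirchSwinnertonDyer.Rank1Residual.GaloisImage.S24Deep
  Summit.BirchSwinnertonDyer.Rank1Residual.X4
  Summit.BirchSwinnertonDyer.BirchSwinnertonDyer.Theorems.KimAtThreeKolyvaginUnitLevelOneRungs
  Summit.BirchSwinnertonDyer.BirchSwinnertonDyer.Theorems.KimAtThreeKolyvaginMinimalCertificate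
  Summit.BirchSwinnertonDyer.BirchSwinnertonDyer.Theorems.KimAtThreeDeepLowerKatoStratumOfFacts

namespace Summit.BirchSwinnertonDyer.BirchSwinnertonDyer.Theorems.KimAtThreeDeepLowerDeepPortWith

/-! ### §1 The deep N11 datum for a GIVEN family of primitive roots `η` -/

/-- **The deep N11 datum exists for a PRESCRIBED `η`** (`TowerPackage`-style re-run of
`S24Deep.exists_eta_kolyvaginDatum_torsion_pow_mul_deep` through n1011's η-input constructor): for
`k ≤ k′`, `τ ∈ Gal(ℚ̄/ℚ(μ_{3^{k′+1}}))` with `E[3^{k+1}]/(τ − 1) ≅ ℤ/3^{k+1}`, any `S`, and `η` with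
`⟨η_𝔮⟩ = (ℤ/N𝔮)ˣ` at every prime: a Kolyvagin datum `D` for `E[3^{k+1}]` with
`D.primes =` the deep class through `E[3^{k′+1}]` at `3^{k′+1}`, cyclotomic transverse conditions and
`D.HasCanonicalComparison 3^{k+1} η`. (Adapted from `Rank1Residual/GaloisImage/KolyvaginDeepDatum.lean`,
credit cell b2b-bsdres n1011.) [cite: Rubin2011, Def. 1.9.6 (p. 14) and Def. 2.1.3 (p. 17)]
[cite: MazurRubin2004, §3.5 (H.5) (p. 27) and Prop. A.2 (pp. 79–80)] -/
theorem exists_kolyvaginDatum_torsion_pow_mul_deep_with (W : WeierstrassCurve ℚ) [W.IsElliptic]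
    {k k' : ℕ} (hk : k ≤ k') (S : Set (HeightOneSpectrum (𝓞 ℚ))) {τ : absoluteGaloisGroup ℚ}
    (hτμ : τ ∈ rootsOfUnityFixer ℚ (3 ^ (k' + 1)))
    (hτq : Nonempty (cokerSubOne (W.torsionGaloisModule (((3 : ℕ) : ℤ) ^ k * ((3 : ℕ) : ℤ))) τ ≃+
      ZMod (3 ^ (k + 1))))
    (η : (q : HeightOneSpectrum (𝓞 ℚ)) → (ZMod (Ideal.absNorm q.asIdeal))ˣ)
    (hη : ∀ q : HeightOneSpectrum (𝓞 ℚ), Subgroup.zpowers (η q) = ⊤) :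
    ∃ D : KolyvaginDatum (W.torsionGaloisModule (((3 : ℕ) : ℤ) ^ k * ((3 : ℕ) : ℤ))),
      D.primes = frobeniusClassPrimes (W.torsionGaloisModule (((3 : ℕ) : ℤ) ^ k' * ((3 : ℕ) : ℤ)))
          S τ (3 ^ (k' + 1)) ∧
        D.transverse = cyclotomicTransverse _ ∧ D.HasCanonicalComparison (3 ^ (k + 1)) η :=
  haveI : NeZero (3 ^ (k + 1)) := ⟨pow_ne_zero _ three_ne_zero⟩
  exists_kolyvaginDatum_hasCanonicalComparison_frobeniusClassPrimes_deep _ _ _ _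
    (fun u hu => torsionGaloisModule_pow_mul_eq_one_of_le W ((3 : ℕ) : ℤ) hk u hu)
    (pow_dvd_pow 3 (Nat.succ_le_succ hk)) S hτμ hτq _ η (fun q _ => hη q)

/-! ### §2 The DEEP family at every depth with ONE SHARED generator `η` -/

/-- **The deep family with a SHARED generator** — `S24Deep.exists_deepFamily_of_towerSurj` (n1011-p15,
F4) with the primitive roots `η` an INPUT common to all depths instead of a per-depth output; every
other clause (deep class at the uniform exponent `max k k′ + t`, cyclotomic transverse conditions,
canonical comparison FOR `η`, `hPP′`, `hPS′`, `hUT′`, [S24] (1)(2) from the two S24-DEEP ports) and its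
proof verbatim (adapted from `Rank1Residual/GaloisImage/KolyvaginDeepFamily.lean`, credit cell b2b-bsdres
n1011). CONDITIONAL on `hS24d`/`hS24d₂`. [cite: Sakamoto2024, Thm. 4.4 (1)(2) (p. 926)]
[cite: MazurRubin2004, §3.5 (H.5) (p. 27) and Prop. A.2 (pp. 79–80)] [cite: Kim2022StructureSelmer, Thm. 3.13] -/
theorem exists_deepFamily_of_towerSurj_with (W : WeierstrassCurve ℚ) [W.IsElliptic]
    (hS24d : kolyvaginSystems_freeRankOne_zmod_three_pow_deep)
    (hS24d₂ : kolyvaginSystems_idealOfBasis_eq_fittingIdeal_zmod_three_pow_deep) (t k : ℕ)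
    (htower : ∀ n : ℕ, W.HasSurjectiveModNGaloisRep (3 ^ n : ℕ))
    (τ : absoluteGaloisGroup ℚ) (hτμ : ∀ n : ℕ, τ ∈ rootsOfUnityFixer ℚ (3 ^ n))
    (hτq : ∀ m : ℕ, Nonempty (cokerSubOne (W.torsionGaloisModule (((3 : ℕ) : ℤ) ^ m * ((3 : ℕ) : ℤ))) τ
      ≃+ ZMod (3 ^ (m + 1))))
    (inv : LocalInvariants ℚ 3) (hperf : inv.IsPerfect) (hsum : inv.SumLocalTermEqZero)
    (hcompl : inv.SelmerComplement)
    (hEP : ∀ v : HeightOneSpectrum (𝓞 ℚ), localEulerPoincareCharacteristic (v.adicCompletion ℚ))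
    (S : Finset (Place ℚ)) (hS : ∀ w : InfinitePlace ℚ, (Sum.inl w : Place ℚ) ∈ S)
    (h3S : ∀ v : HeightOneSpectrum (𝓞 ℚ), ((3 : ℕ) : 𝓞 ℚ) ∈ v.asIdeal → (Sum.inr v : Place ℚ) ∈ S)
    (hbadS : ∀ v : HeightOneSpectrum (𝓞 ℚ), ¬ W.HasGoodReductionAt v → (Sum.inr v : Place ℚ) ∈ S)
    (hfinT : ∀ k' : ℕ, Finite (geomTorsion W (((3 : ℕ) : ℤ) ^ k' * ((3 : ℕ) : ℤ))))
    (η : (q : HeightOneSpectrum (𝓞 ℚ)) → (ZMod (Ideal.absNorm q.asIdeal))ˣ)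
    (hη : ∀ q : HeightOneSpectrum (𝓞 ℚ), Subgroup.zpowers (η q) = ⊤) :
    ∃ (D : ∀ k' : ℕ, KolyvaginDatum (W.torsionGaloisModule (((3 : ℕ) : ℤ) ^ k' * ((3 : ℕ) : ℤ))))
      (g : ∀ k' : ℕ, Finset (HeightOneSpectrum (𝓞 ℚ)) →
        galoisCohomology (W.torsionGaloisModule (((3 : ℕ) : ℤ) ^ k' * ((3 : ℕ) : ℤ))) 1),
      (∀ k', (D k').primes = frobeniusClassPrimes
          (W.torsionGaloisModule (((3 : ℕ) : ℤ) ^ (max k k' + t) * ((3 : ℕ) : ℤ)))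
          {v | (Sum.inr v : Place ℚ) ∈ S} τ (3 ^ (max k k' + t + 1))) ∧
      (∀ k', (D k').transverse = cyclotomicTransverse _) ∧
      (∀ k', (D k').HasCanonicalComparison (3 ^ (k' + 1)) η) ∧
      (∀ k', (D k').primes ⊆ (D k).primes) ∧
      (∀ k', ∀ q ∈ (D k').primes, (Sum.inr q : Place ℚ) ∉ S) ∧
      (∀ k', ∀ q ∈ (D k').primes,
        Nat.card (unramifiedSubgroup (GaloisRep.toLocal q
          (W.torsionGaloisModule (((3 : ℕ) : ℤ) ^ k' * ((3 : ℕ) : ℤ)))) 1) =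
          Nat.card ((D k').transverse (Sum.inr q))) ∧
      (∀ k', g k' ∈ (D k').kolyvaginSystems (propagatedSelmerStructure W 3 k')) ∧
      (∀ k', addOrderOf (g k') = 3 ^ (k' + 1)) ∧
      (∀ k', ∀ κ ∈ (D k').kolyvaginSystems (propagatedSelmerStructure W 3 k'), ∃ a : ℕ, κ = a • g k') ∧
      (∀ k' (inv' : LocalInvariants ℚ (3 ^ (k' + 1))), inv'.IsPerfect → inv'.SumLocalTermEqZero →
        inv'.SelmerComplement → ∀ d, (D k').IsLevel d →
          (Nat.card (inv'.dualSelmerStructure _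
              ((D k').atLevel (propagatedSelmerStructure W 3 k') d)).selmerGroup ∣ 3 ^ (k' + 1) →
            addOrderOf (g k' d) * Nat.card (inv'.dualSelmerStructure _
              ((D k').atLevel (propagatedSelmerStructure W 3 k') d)).selmerGroup = 3 ^ (k' + 1)) ∧
          (3 ^ (k' + 1) ∣ Nat.card (inv'.dualSelmerStructure _
              ((D k').atLevel (propagatedSelmerStructure W 3 k') d)).selmerGroup → g k' d = 0)) := by
  haveI : Fact (Nat.Prime 3) := ⟨Nat.prime_three⟩
  have hle : ∀ k' : ℕ, k' ≤ max k k' + t := fun k' => (le_max_right k k').trans (Nat.le_add_right _ _)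
  -- the datum at every depth, canonical for the SAME `η`
  have hdat := fun k' : ℕ => exists_kolyvaginDatum_torsion_pow_mul_deep_with W (hle k')
    {v | (Sum.inr v : Place ℚ) ∈ S} (hτμ _) (hτq k') η hη
  choose D hP hT hD using hdat
  -- the generator at every depth (n1011's [S24]-deep instance, `η` given)
  have hgen := fun k' : ℕ =>
    haveI : Finite (geomTorsion W ((3 : ℕ) : ℤ)) := by
      simpa only [pow_zero, one_mul] using finite_geomTorsion_pow_mul W 3 0
    exists_generator_kolyvaginSystems_deep_of_towerSurj W hS24d hS24d₂ (hle k') htower τ (hτμ _)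
      (hτq _) inv hperf hsum hcompl hEP S hS h3S hbadS (D k') η (hP k') (hT k') (hD k')
  choose κ hκ hgo hgen' hR22 using hgen
  refine ⟨D, fun k' => (κ k').1, hP, hT, hD, fun k' => ?_, fun k' => ?_, fun k' => ?_,
    fun k' => (κ k').2, hgo, hgen', fun k' inv' hperf' hsum' hcompl' d hd =>
      hR22 k' inv' hperf' hsum' hcompl' d hd⟩
  · exact primes_subset_torsion_pow_mul_deep W
      (Nat.add_le_add_right ((max_self k).le.trans (le_max_left k k')) t |>.trans_eq' (by rw [max_self]))
      (hP k) (hP k')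
  · exact not_mem_of_primes_eq_deep _ _ _ (hP k')
  · exact natCard_unramifiedSubgroup_eq_natCard_transverse_torsion_pow_mul_deep W (hle k') (hP k')
      (hT k') (hτμ _) (hτq k')

/-! ### §3 Cor C-t in BSD currency for every `t` and every depth, GRANTED PORT′ (shared `η`) -/

/-- **Cor C-t, every `t`, every depth, REPAIRED port.** `W/ℚ` globally minimal, ADDITIVE at `3` with
`3 ∤ c₃`, the `3`-adic tower onto, `#E(ℚ₃)[3] = 3^t`, `L(E,1) ≠ 0`, a datum `D` with `3 ∤ c_D` and the
`3`-adic period transfer; GRANTED `hS24d`/`hS24d₂`, `hGZK`, `hPT`, primitive roots `η` generating every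
`(ℤ/N𝔮)ˣ` and the SHARED-`η` port `KatoKuriharaPortThreeAtWith W t v₃ η`; a depth `k`, modulus `3^j`
with `t + j ≤ k + 1`, and a MINIMAL certificate at a cyclic `n ∈ 𝒩_{k+t+1}(E,3)` with `ℓ ∤ N` for `ℓ ∣ n`
⟹ `∃ q, L(E,1)/Ω(W) = q ∧ ord₃ q ≤ ord₃ #Ш(E/ℚ)(3) + (j − 1)`. Proof = n1011's
`Assembly.exists_LOmega_padicValRat_le_of_towerSurj_deep` (credit cell b2b-bsdres n1011) on the
shared-`η` deep family of §2, the guards being With-guards for `η`, the dictionary unpacked by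
`KatoKuriharaPortThreeAtWith.dictionary₂`. [cite: Kim2022StructureSelmer, Thm. 1.9 (6) and Thm. 3.13]
[cite: Sakamoto2024, Thm. 4.4 (p. 926)] [cite: MazurRubin2004, §3.5 (H.5) (p. 27) and Prop. A.2 (pp. 79–80)]
[cite: MilneADT2006, Ch. I, Thm. 4.10] -/
theorem exists_LOmega_padicValRat_le_of_towerSurj_deep_with
    (hS24d : S24Deep.kolyvaginSystems_freeRankOne_zmod_three_pow_deep)
    (hS24d₂ : S24Deep.kolyvaginSystems_idealOfBasis_eq_fittingIdeal_zmod_three_pow_deep)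
    (hGZK : rank_eq_analyticRank_of_analyticRank_le_one)
    (hPT : poitouTate_selmerStructure_duality ℚ)
    (W : WeierstrassCurve ℚ) [W.IsElliptic] [W.IsGloballyMinimal] (t k : ℕ)
    -- the row
    (hadd : haveI : Fact (Nat.Prime 3) := ⟨Nat.prime_three⟩; Addv W 3)
    (hc3 : ¬ 3 ∣ (W.baseChange ℚ_[3]).localTamagawaNumber ℤ_[3])
    (htower : ∀ m : ℕ, W.HasSurjectiveModNGaloisRep (3 ^ m : ℕ))
    (ht : Nat.card {Q : (W.baseChange ℚ_[3]).toAffine.Point // (3 : ℕ) • Q = 0} = 3 ^ t)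
    (hL : W.entireLFunction 1 ≠ 0)
    {N : ℕ} [NeZero N] (D : ModularParametrizationData W N)
    (hcD : ¬ (3 : ℤ) ∣ D.maninConstant)
    (hper : ∃ u : ℚ, ‖(u : ℚ_[3])‖ = 1 ∧ W.realPeriodRat = u * plusPeriod D.f)
    -- ONE repaired port (PORT′, shared generator family `η`)
    (v₃ : HeightOneSpectrum (𝓞 ℚ)) (hv₃ : ((3 : ℕ) : 𝓞 ℚ) ∈ v₃.asIdeal)
    (η : (q : HeightOneSpectrum (𝓞 ℚ)) → (ZMod (Ideal.absNorm q.asIdeal))ˣ)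
    (hη : ∀ q : HeightOneSpectrum (𝓞 ℚ), Subgroup.zpowers (η q) = ⊤)
    (hPort : KatoKuriharaPortThreeAtWith W t v₃ η)
    -- the certificate at `n ∈ 𝒩_{k+t+1}`, modulus `3^j`, `t + j ≤ k + 1`
    (n : ℕ) [NeZero n] (hn : Kato.IsKolyvaginProduct W 3 (k + t + 1) n)
    (hcyc : ∀ (ℓ : ℕ) [Fact ℓ.Prime], ℓ ∣ n →
      Nat.card {P : ((integralModelInt W).map (Int.castRingHom (ZMod ℓ))).toAffine.Point //
        3 • P = 0} ≤ 3)
    (hnN : ∀ ℓ ∈ n.primeFactors, ¬ ℓ ∣ N) {j : ℕ} (htj : t + j ≤ k + 1)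
    (ψ : (ℓ : ℕ) → (ZMod ℓ)ˣ →* Multiplicative (ZMod (3 ^ j)))
    (hψ : ∀ ℓ ∈ n.primeFactors, Function.Surjective (ψ ℓ))
    (hcert : kuriharaNumber D.f (3 ^ j) n ψ ≠ 0)
    (hv : ∀ d : ℕ, d ∣ n → 1 < d → d < n → ∀ [NeZero d], kuriharaNumber D.f (3 ^ j) d ψ = 0) :
    ∃ q : ℚ, W.entireLFunction 1 / (W.realPeriodRat : ℂ) = (q : ℂ) ∧
      padicValRat 3 q ≤
        (padicValNat 3 (Nat.card (AddCommGroup.primaryComponent W.sha 3)) : ℤ) + ((j - 1 : ℕ) : ℤ) := by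
  haveI : Fact (Nat.Prime 3) := ⟨Nat.prime_three⟩
  -- the row: analytic rank `0`, `E(ℚ)` and `Ш` finite, surj(3)
  have hr : W.analyticRank = 0 := analyticRank_eq_zero_of_entireLFunction_one_ne_zero hL
  have hGZ := hGZK W (by rw [hr]; exact zero_le_one)
  haveI : Finite W.sha := hGZ.2
  haveI : Finite W.toAffine.Point := W.mordellWeilRank_eq_zero_iff_holds.mp (by rw [hGZ.1, hr])
  have hsurj : W.HasSurjectiveModNGaloisRep ((3 : ℕ) : ℤ) := by simpa using htower 1
  have hcP : ¬ ((3 : ℕ) : ℤ) ∣ D.maninConstant := by exact_mod_cast hcD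
  -- the Poitou–Tate families (named fact) and Tate's local Euler–Poincaré characteristic (theorem)
  obtain ⟨inv, hperf, hsum, -, hcompl⟩ := hPT 3
  obtain ⟨inv', hperf', hsum', hcompl', hinj'⟩ := exists_localInvariants_three_pow_of_poitouTate hPT
  have hEP : ∀ v : HeightOneSpectrum (𝓞 ℚ), localEulerPoincareCharacteristic (v.adicCompletion ℚ) :=
    localEulerPoincareCharacteristic_rat
  -- the admissible set `T = {v ∣ 3} ∪ {bad}` and `S = S(T)` (n1011, verbatim)
  obtain ⟨T, h3T, hbadT, hTmem, hT, h𝓕T, h𝓚T, hfinT, hfinS⟩ := TowerPackage.towerAdmissible W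
  have hS : ∀ w : InfinitePlace ℚ, (Sum.inl w : Place ℚ) ∈ finSupport T := inl_mem_finSupport T
  have h3S : ∀ v : HeightOneSpectrum (𝓞 ℚ), ((3 : ℕ) : 𝓞 ℚ) ∈ v.asIdeal →
      (Sum.inr v : Place ℚ) ∈ finSupport T := fun v hv => (inr_mem_finSupport_iff T v).mpr (h3T v hv)
  have hbadS : ∀ v : HeightOneSpectrum (𝓞 ℚ), ¬ W.HasGoodReductionAt v →
      (Sum.inr v : Place ℚ) ∈ finSupport T := fun v hv => (inr_mem_finSupport_iff T v).mpr (hbadT v hv)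
  have hSgood : ∀ v ∉ {v : HeightOneSpectrum (𝓞 ℚ) | (Sum.inr v : Place ℚ) ∈ finSupport T},
      W.HasGoodReductionAt v ∧ ((3 : ℕ) : 𝓞 ℚ) ∉ v.asIdeal := fun v hv =>
    ⟨by_contra fun h => hv (hbadS v h), fun h => hv (h3S v h)⟩
  -- ONE `τ` for all levels, and the SHARED-`η` deep family (§2)
  obtain ⟨τ, hτμ, hτq⟩ := S24Deep.exists_tau_forall_levels_of_towerSurj W htower
  obtain ⟨D', g', hP', hDT', hD', hPP', hPS', hUT', hg', hgo', hgen', hR22'⟩ :=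
    exists_deepFamily_of_towerSurj_with W hS24d hS24d₂ t k htower τ hτμ hτq inv hperf hsum hcompl hEP
      (finSupport T) hS h3S hbadS hfinT η hη
  -- the reduction maps
  choose red hred using fun k' => exists_torsionReduction_three W k k'
  -- the With-guards for the shared `η`
  have hguard : ∀ k' m, m ≤ max k k' + t → (D' k').IsCanonicalTauDatumThreeAtWith W m k' η :=
    fun k' m hm => ⟨hDT' k', hD' k', _, τ, hSgood, hτμ _, hτq _, (hP' k').le.trans
      (S24Deep.frobeniusClassPrimes_torsion_pow_mul_mono W ((3 : ℕ) : ℤ) hm _ τ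
        (pow_dvd_pow 3 (by omega)))⟩
  have hdict := hPort.dictionary₂ (hguard k (k + t) (by omega)) (fun k' => hguard k' (k' + t) (by omega))
    red
  -- surjectivity at the class level `3^{k+t+1}` from the tower
  have hsurjK : W.HasSurjectiveModNGaloisRep (((3 : ℕ) : ℤ) ^ (max k k + t) * ((3 : ℕ) : ℤ)) := by
    simpa only [Nat.cast_pow, Nat.cast_mul, pow_succ] using htower (max k k + t + 1)
  have hn' : Kato.IsKolyvaginProduct W 3 (max k k + t + 1) n := by rw [max_self]; exact hn
  -- n1011's END theorem with everything discharged
  exact padicValRat_le_of_kolyvaginProduct_deep W t k (max k k + t) (D' k) v₃ hv₃ hadd hc3 hsurj ht hL D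
    hcP hper (hDT' k) (g' k) (hg' k) (hgen' k) D' hDT' hPP' red hred hdict g' hg' hgo' hgen' inv' hperf'
    hsum' hcompl' hinj' hEP (fun _ => T) (fun _ => h3T v₃ hv₃) hT h𝓕T h𝓚T hfinT hfinS
    (fun q hq => fun h => hPS' k q hq ((inr_mem_finSupport_iff T q).mpr h))
    (fun k' q hq => fun h => hPS' k' q hq ((inr_mem_finSupport_iff T q).mpr h))
    (hUT' k) hUT'
    (fun d hd => hR22' k (inv' k) (hperf' k) (hsum' k) (hcompl' k) d hd)
    (fun k' d hd => hR22' k' (inv' k') (hperf' k') (hsum' k') (hcompl' k') d hd)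
    (hτμ _) (hτq _) (hP' k) hsurjK n hn'
    (fun v hv => natCard_torsionBy_reductionAt_le_of_dvd W 3 hcyc hv)
    (fun v hv h => by
      obtain ⟨hgood, h3⟩ := hasGoodReductionAt_and_not_mem_of_kolyvaginProduct W 3 hn hv
      rcases hTmem v ((inr_mem_finSupport_iff T v).mp h) with hbad | h3v
      · exact hbad hgood
      · exact h3 h3v)
    hnN htj ψ hψ hcert hv

/-! ### §4 The `∂`-currency conclusion of item 19075, every `t`, GRANTED PORT′ -/

/-- **Crux `DeepLowerAtThree` for every `t`, GRANTED the REPAIRED deep ports.** For `W/ℚ` globally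
minimal, ADDITIVE at `3` with `3 ∤ c₃`, the `3`-adic tower onto, `#E(ℚ₃)[3] = 3^t`, a parametrisation
datum `D` at the conductor (`N = N_E`) with `3 ∤ c_D` and the period transfer, primitive roots `η`, the
port `KatoKuriharaPortThreeAtWith W t v₃ η`, and `ord(δ̃) = 0`; GRANTED `hS24d`/`hS24d₂`, `hGZK`, `hPT`:
`∂^{(∞)}_deep(δ̃) = d ∈ ℕ` and `∂⁽⁰⁾(δ̃) ≤ ord₃ #Ш(E/ℚ)(3) + d` for `(W, D.f)` — kim3's END-shape bridge
`deepLower_datum_of_endShapeBound` at `K = 2t + 1` over §3 at `k = L − t − 1`. Nothing asserted.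
[cite: Kim2025RefinedTNC, Thm 1.1] [cite: Kim2022StructureSelmer, Thm. 1.9 (6), Thm. 3.13]
[cite: Sakamoto2024, Thm. 4.4 (p. 926)] [cite: MazurRubin2004, Thm. 5.2.12, Cor. 5.2.13] -/
theorem deepLower_datum_of_deepPortsWith
    (hS24d : S24Deep.kolyvaginSystems_freeRankOne_zmod_three_pow_deep)
    (hS24d₂ : S24Deep.kolyvaginSystems_idealOfBasis_eq_fittingIdeal_zmod_three_pow_deep)
    (hGZK : rank_eq_analyticRank_of_analyticRank_le_one)
    (hPT : poitouTate_selmerStructure_duality ℚ)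
    (W : WeierstrassCurve ℚ) [W.IsElliptic] [W.IsGloballyMinimal] (t : ℕ)
    (hadd : haveI : Fact (Nat.Prime 3) := ⟨Nat.prime_three⟩; Addv W 3)
    (hc3 : ¬ 3 ∣ (W.baseChange ℚ_[3]).localTamagawaNumber ℤ_[3])
    (htower : ∀ m : ℕ, W.HasSurjectiveModNGaloisRep (3 ^ m : ℕ))
    (ht : Nat.card {Q : (W.baseChange ℚ_[3]).toAffine.Point // (3 : ℕ) • Q = 0} = 3 ^ t)
    {N : ℕ} [NeZero N] (hNc : N = W.conductorNorm ℤ) (D : ModularParametrizationData W N)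
    (hcD : ¬ (3 : ℤ) ∣ D.maninConstant)
    (hper : ∃ u : ℚ, ‖(u : ℚ_[3])‖ = 1 ∧ W.realPeriodRat = u * plusPeriod D.f)
    (v₃ : HeightOneSpectrum (𝓞 ℚ)) (hv₃ : ((3 : ℕ) : 𝓞 ℚ) ∈ v₃.asIdeal)
    (η : (q : HeightOneSpectrum (𝓞 ℚ)) → (ZMod (Ideal.absNorm q.asIdeal))ˣ)
    (hη : ∀ q : HeightOneSpectrum (𝓞 ℚ), Subgroup.zpowers (η q) = ⊤)
    (hPort : KatoKuriharaPortThreeAtWith W t v₃ η)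
    (hord : kuriharaVanishingOrder W 3 D.f = 0) :
    ∃ d : ℕ, kuriharaPartialDeepInfty W 3 D.f = d ∧
      kuriharaPartial W 3 D.f 0 ≤
        ((padicValNat 3 (Nat.card (AddCommGroup.primaryComponent W.sha 3)) + d : ℕ) : ℕ∞) := by
  haveI : Fact (Nat.Prime 3) := ⟨Nat.prime_three⟩
  have h0 : ratPlusSymbol D.f 0 ≠ 0 :=
    ratPlusSymbol_zero_ne_zero_of_kuriharaVanishingOrder_eq_zero W 3 D.f hord
  have hL : W.entireLFunction 1 ≠ 0 :=
    D.isNewformOf.entireLFunction_one_ne_zero_of_ratPlusSymbol_zero_ne_zero h0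
  refine deepLower_datum_of_endShapeBound W htower D hper hord (2 * t + 1) ?_
  intro j' L n hj' hKL hcyc hLn ψ hψ hne hv
  haveI : NeZero n := ⟨hLn.ne_zero⟩
  have hk : L - t - 1 + t + 1 = L := by omega
  have hn' : Kato.IsKolyvaginProduct W 3 (L - t - 1 + t + 1) n := by rw [hk]; exact hLn
  exact exists_LOmega_padicValRat_le_of_towerSurj_deep_with hS24d hS24d₂ hGZK hPT W t (L - t - 1)
    hadd hc3 htower ht hL D hcD hper v₃ hv₃ η hη hPort n hn' (fun ℓ _ hℓ => hcyc.2 ℓ hℓ)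
    (fun ℓ hℓ hℓN => (hLn.2 ℓ hℓ).not_dvd_conductorNorm (hNc ▸ hℓN)) (j := j') (by omega) ψ hψ
    hne hv

/-- **The same for an OPTIMAL datum with `3 ∤ c_D`** (period transfer by `X4.periodTransfer_of_optimal`),
every `t`, any conductor. [cite: Kim2025RefinedTNC, Thm 1.1] [cite: CremonaAlgorithms1997, §2.8 (p. 26)]
[cite: Sakamoto2024, Thm. 4.4 (p. 926)] -/
theorem deepLower_optimal_of_deepPortsWith
    (hS24d : S24Deep.kolyvaginSystems_freeRankOne_zmod_three_pow_deep)
    (hS24d₂ : S24Deep.kolyvaginSystems_idealOfBasis_eq_fittingIdeal_zmod_three_pow_deep)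
    (hGZK : rank_eq_analyticRank_of_analyticRank_le_one)
    (hPT : poitouTate_selmerStructure_duality ℚ)
    (W : WeierstrassCurve ℚ) [W.IsElliptic] [W.IsGloballyMinimal] (t : ℕ)
    (hadd : haveI : Fact (Nat.Prime 3) := ⟨Nat.prime_three⟩; Addv W 3)
    (hc3 : ¬ 3 ∣ (W.baseChange ℚ_[3]).localTamagawaNumber ℤ_[3])
    (htower : ∀ m : ℕ, W.HasSurjectiveModNGaloisRep (3 ^ m : ℕ))
    (ht : Nat.card {Q : (W.baseChange ℚ_[3]).toAffine.Point // (3 : ℕ) • Q = 0} = 3 ^ t)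
    {N : ℕ} [NeZero N] (hNc : N = W.conductorNorm ℤ) (D : ModularParametrizationData W N)
    (hopt : ∀ z ∈ D.L.lattice, ∃ w ∈ periodLattice D.f, z = D.c * w)
    (hcD : ¬ (3 : ℤ) ∣ D.maninConstant)
    (v₃ : HeightOneSpectrum (𝓞 ℚ)) (hv₃ : ((3 : ℕ) : 𝓞 ℚ) ∈ v₃.asIdeal)
    (η : (q : HeightOneSpectrum (𝓞 ℚ)) → (ZMod (Ideal.absNorm q.asIdeal))ˣ)
    (hη : ∀ q : HeightOneSpectrum (𝓞 ℚ), Subgroup.zpowers (η q) = ⊤)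
    (hPort : KatoKuriharaPortThreeAtWith W t v₃ η)
    (hord : kuriharaVanishingOrder W 3 D.f = 0) :
    ∃ d : ℕ, kuriharaPartialDeepInfty W 3 D.f = d ∧
      kuriharaPartial W 3 D.f 0 ≤
        ((padicValNat 3 (Nat.card (AddCommGroup.primaryComponent W.sha 3)) + d : ℕ) : ℕ∞) :=
  haveI : Fact (Nat.Prime 3) := ⟨Nat.prime_three⟩
  deepLower_datum_of_deepPortsWith hS24d hS24d₂ hGZK hPT W t hadd hc3 htower ht hNc D hcD
    (periodTransfer_of_optimal 3 D hopt hcD) v₃ hv₃ η hη hPort hord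

/-- **Crux 19075's conclusion for EVERY newform `f` of `W` at the level of an optimal datum, every `t`**
(multiplicity one `IsNewformOf.unique`: such an `f` IS `D.f`), GRANTED the repaired deep ports.
[cite: Kim2025RefinedTNC, Thm 1.1] [cite: Sakamoto2024, Thm. 4.4 (p. 926)] [cite: Carayol1986] -/
theorem deepLower_newform_of_deepPortsWith
    (hS24d : S24Deep.kolyvaginSystems_freeRankOne_zmod_three_pow_deep)
    (hS24d₂ : S24Deep.kolyvaginSystems_idealOfBasis_eq_fittingIdeal_zmod_three_pow_deep)
    (hGZK : rank_eq_analyticRank_of_analyticRank_le_one)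
    (hPT : poitouTate_selmerStructure_duality ℚ)
    (W : WeierstrassCurve ℚ) [W.IsElliptic] [W.IsGloballyMinimal] (t : ℕ)
    (hadd : haveI : Fact (Nat.Prime 3) := ⟨Nat.prime_three⟩; Addv W 3)
    (hc3 : ¬ 3 ∣ (W.baseChange ℚ_[3]).localTamagawaNumber ℤ_[3])
    (htower : ∀ m : ℕ, W.HasSurjectiveModNGaloisRep (3 ^ m : ℕ))
    (ht : Nat.card {Q : (W.baseChange ℚ_[3]).toAffine.Point // (3 : ℕ) • Q = 0} = 3 ^ t)
    {N : ℕ} [NeZero N] (hNc : N = W.conductorNorm ℤ) (D : ModularParametrizationData W N)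
    (hopt : ∀ z ∈ D.L.lattice, ∃ w ∈ periodLattice D.f, z = D.c * w)
    (hcD : ¬ (3 : ℤ) ∣ D.maninConstant)
    (v₃ : HeightOneSpectrum (𝓞 ℚ)) (hv₃ : ((3 : ℕ) : 𝓞 ℚ) ∈ v₃.asIdeal)
    (η : (q : HeightOneSpectrum (𝓞 ℚ)) → (ZMod (Ideal.absNorm q.asIdeal))ˣ)
    (hη : ∀ q : HeightOneSpectrum (𝓞 ℚ), Subgroup.zpowers (η q) = ⊤)
    (hPort : KatoKuriharaPortThreeAtWith W t v₃ η)
    (f : CuspForm (Gamma0 N) 2) (hf : IsNewformOf W f) (hord : kuriharaVanishingOrder W 3 f = 0) :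
    ∃ d : ℕ, kuriharaPartialDeepInfty W 3 f = d ∧
      kuriharaPartial W 3 f 0 ≤
        ((padicValNat 3 (Nat.card (AddCommGroup.primaryComponent W.sha 3)) + d : ℕ) : ℕ∞) := by
  obtain rfl : f = D.f := hf.unique D.isNewformOf
  exact deepLower_optimal_of_deepPortsWith hS24d hS24d₂ hGZK hPT W t hadd hc3 htower ht hNc D hopt hcD
    v₃ hv₃ η hη hPort hord

end Summit.BirchSwinnertonDyer.BirchSwinnertonDyer.Theorems.KimAtThreeDeepLowerDeepPortWith

end
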